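import Literature.AnabelianGeometry.EtaleTheta.Discharge.Sec4Prop42OfConnectedTemperoid
import Literature.AnabelianGeometry.EtaleTheta.Discharge.Sec4Prop42SubLawsAtDef22Ctx
import Literature.AnabelianGeometry.EtaleTheta.BiKummerThm44SubNHSatFaithful
import Literature.AnabelianGeometry.EtaleTheta.BiKummerThm44SubGaloisDescent
import Literature.AlgebraicGeometry.Frobenioids.ModelFrobenioidAutAction
import HarnessLib

/-!
# [EtTh] Prop. 4.2 (iii)/(iv): the HULL CLAUSES of the [FrdII] Def. 2.2 (ii) reading, DISCHARGED over the
# genuine connected base `B^temp(Π^tp_X)⁰`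

S. Mochizuki, *The étale theta function and its Frobenioid-theoretic manifestations*, Publ. RIMS **45** (2009)
[MochizukiEtTh2009], §4, Prop. 4.2 (iii)/(iv), proof PDF p.90 (printed p.316) L14–17: «it follows from the
"`(N, H_⊙, f|_{A_N})`-saturated-ness" condition … [cf. also Proposition 3.4, (ii)] that the pull-back `∈ O^×(A_N)` …
of any element `∈ O^×(A_⊙)` … admits an `N`-th root»; Def. 4.1 pp.86–87 («the open subgroup `H_⊙ ⊆ Π^tp_X`
determined by `A_⊙^bs`», (ii) «natural surjective outer homomorphism `Π^tp_X ↠ Aut_D(A^bs)`»).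
S. Mochizuki, *The geometry of Frobenioids I*, Kyushu J. Math. **62** (2008) [MochizukiFrdI2008], Thm. 5.2 (i)–(iii)
pp.100–101 (the model Frobenioid: morphisms `(deg_Fr, Base, Div, u)`, `O^×(−) ↔ Ker(Div_B)`, Frobenius-trivial ⇔
principal).  S. Mochizuki, *The geometry of Frobenioids II* [MochizukiFrdII2008], Def. 2.1 (i) p.16 (`μ_N`-saturated),
Def. 2.2 (i)(ii) p.17, Rmk. 2.2.1 p.18.  [cite: MochizukiEtTh2009, Prop 4.2 p.90] [cite: MochizukiFrdI2008, Thm. 5.2 p.100]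

abc-iut cell, layer L2, DAG nodes `EtTh:Prop4.2(iii)` / `EtTh:Prop4.2(iv)` (plan/L2/CONE-L2-STATUS rows of the
abc-iut-w4-d044 lineage; residual «GAP D-G-w4d044-1, D-G-w4d044-2»); seat abc-iut-w4-d044 (gen 5).  PROOF-ONLY (0 `def`s,
no instance, no new named fact; nothing landed is edited or restated; abc-iut-w6-d047's B2 datum `def22Ctx` (p460958), its
`Aut`-ampleness lemma `exists_aut_mapAut_eq_of_isFrobeniusTrivial` (p461844) and `refinementLaw_of_def22Ctx` (p463642,
`hE` with `hgal`/`hmu` discharged) are consumed BY NAME).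

WHAT THIS FILE DOES.  `Sec4Prop42SubLawsOfDef22Reading.lean` (this lineage, gen 4, p457351) re-keyed the node floor's two
GAP laws `hL` (G-w4d044-1, roots of constants) / `hE` (G-w4d044-2, saturating refinement) on the FAITHFUL [FrdII] Def. 2.2
(ii) reading of the `(N, H_⊙^{bs-fld})`-saturation slot, leaving a DICTIONARY {`ctx`, `hNH`, `ιO`, `hconst`, `hmu`, `hgal`};
`Sec4Prop42SubLawsAtDef22Ctx.lean` (abc-iut-w6-d047) instantiated `ctx := def22Ctx` and discharged `hmu`, `hgal`.  Here the
rest goes: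
* §B model-Frobenioid lemmas ([FrdI] Thm. 5.2): `exists_mem_units_unit_eq` (a unit carrying a prescribed `Div_B`-trivial
  function — the hull map `ιO := u ↦ u_u` is ONTO the constants), `conj_eq_self_of_pull_unit_eq` (conjugation by `α`
  fixes a unit whose function is `Base(α)`-invariant).
* §C over `B^temp(Π^tp_X)⁰` (abc-iut-L2-t4's `mkOfConnectedTemperoid`, any slot `NH`): `galoisSurj_hom_comp_eq_of_mem_Hodot`
  — the deck transformations named by `H_⊙ = Ker(Π^tp_X ↠ Aut(A_⊙^bs))` lie OVER every `A^bs ⟶ A_⊙^bs` (Def. 4.1 (ii)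
  naturality, a theorem there, + normality), so `hconst` is a THEOREM, and
  `Prop42Sub.constantRoots_mkOfConnectedTemperoid_of_invariantUnitRoots`: **`hL` ⟸ `hroot`** := «every unit of a
  Frobenius-trivial `NH`-saturated `A″` over `A_⊙` fixed under conjugation by all lifts of `H_⊙`-deck transformations
  has an `N`-th root in `O^×(A″)`»; `…prop42_iii_iv_mkOfConnectedTemperoid_of_invariantUnitRoots` ⟸ {`Φ` divisorial,
  `hDSpull`, `hR`, `hE`, `hroot`} (with abc-iut-w6-d037's `prop42_iii_iv_mkOfConnectedTemperoid_of_laws`).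
* §D at the B2 datum: `Prop42Sub.invariantUnitRoots_of_def22Ctx` — **`hroot` ⟸ [FrdII] Rmk. 2.2.1 BY NAME**
  (`PadicKummer.SaturatedInvariantsAdmitRoots (def22Ctx A″) N`: its `H_A = Im(H_⊙^{bs-fld})` consists of
  `outer (aug g̃) = aug_*(galoisSurj g̃) = res α` for lifts `α` of `H_⊙`-deck transformations, and `res α • u = α u α⁻¹`);
  `…_of_def22Ctx_reading` (any slot `NHf` READING Def. 2.2 (ii) saturation of `def22Ctx` by an `Iff`) and
  `Prop42Sub.prop42_iii_iv_mkOfConnectedTemperoid_faithful` — **[EtTh] Prop. 4.2 (iii) ∧ (iv) AS TYPED over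
  `B^temp(Π^tp_X)⁰` with the slot INSTANTIATED by «`def22Ctx A` is `(N, H)`-saturated» (reading `Iff.rfl`) ⟸ {`Φ`
  divisorial, `hDSpull`, `hR` (G-w4d044-3, abc-iut-L2-t3 lineage)} ∪ {B2 data `haug`/`act`/`hact`} ∪ {[FrdII]
  Rmk. 2.2.1 ×2 AT THE INSTANCE, BY NAME: `hex`, `h221`}** — no dictionary binder, no `hS`/`hHn`/`hHo`; GAP rows
  G-w4d044-1 (`hL`) and G-w4d044-2 (`hE`) CLOSED at the faithful reading.
HONEST FRAMING: [EtTh]/[FrdI]/[FrdII] are refereed prerequisite papers; the remaining binders are print's own hypotheses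
(the B2 context data and [FrdII] Rmk. 2.2.1 at the instance) BY NAME, typed ≠ proved for them; nothing here bears on,
or takes a side on, the disputed [IUTchIII] Cor. 3.12; nothing here asserts abc proved or refuted.
-/

noncomputable section

open CategoryTheory Opposite

universe u₀ v₀ u v w

/-! ## §B. Model-Frobenioid lemmas ([FrdI] Thm. 5.2) -/

namespace Literature.AlgebraicGeometry.Frobenioids.ModelFrobenioid

variable {D : Type u} [Category.{v} D] {Φ B : Dᵒᵖ ⥤ CommMonCat.{w}} {DivB : B ⟶ monoidGp Φ}

/-- **A unit carrying a prescribed `Div_B`-trivial function** ([FrdI] Thm. 5.2 (ii) «`O^×(−)` on `C^birat` is `B`»,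
i.e. `O^×(A) = Ker(Div_B)` for the model Frobenioid; `B(A_D)` group-like): for `w ∈ B(A_D)` with `Div_B(w) = 0`
the base-identity linear automorphism `(1, id, 0, w)` is a unit `u ∈ O^×(A)` with `u_u = w`.
[cite: MochizukiFrdI2008, Thm. 5.2 (ii) p.101] -/
theorem exists_mem_units_unit_eq (X : ModelFrobenioid Φ B DivB) (hB : IsGroupLike (B.obj (op X.base)))
    (w : B.obj (op X.base)) (hw : divB Φ B DivB (op X.base) w = 1) :
    ∃ u : Aut X, u ∈ units X ∧ unit u.hom = w := by
  obtain ⟨wu, hwu⟩ := hB.isUnit w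
  have h1 : Algebra.GrothendieckGroup.of (1 : Φ.obj (op X.base)) = divB Φ B DivB (op X.base) w := by
    rw [map_one, hw]
  have h1' : Algebra.GrothendieckGroup.of (1 : Φ.obj (op X.base)) = divB Φ B DivB (op X.base) ↑wu⁻¹ := by
    have h : divB Φ B DivB (op X.base) ↑wu⁻¹ * divB Φ B DivB (op X.base) w = 1 := by
      rw [← map_mul, ← hwu, Units.inv_mul, map_one]
    rw [hw, mul_one] at h
    rw [map_one, h]
  exact ⟨unitAut X 1 1 w ↑wu⁻¹ h1 h1' (mul_one 1) (by rw [← hwu, Units.inv_mul]),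
    unitAut_mem_units _ _ _ _ _ _ _ _ _, rfl⟩

/-- **Conjugation-invariance of a unit whose function is fixed by `Base(α)`** ([FrdI] Thm. 5.2 (i) composition law,
`unit_conj'`: `u_{α⁻¹ u α} = Base(α⁻¹)^* u_u`; `Φ(A_D)` sharp so `Div(u) = 0`): if `Base(α⁻¹)^* u_u = u_u` then
`α u α⁻¹ = u` in `Aut_C(A)`. [cite: MochizukiFrdI2008, Thm. 5.2 (i) p.100] -/
theorem conj_eq_self_of_pull_unit_eq {X : ModelFrobenioid Φ B DivB} (hΦ : IsSharp (Φ.obj (op X.base)))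
    {u : Aut X} (hu : u ∈ units X) (α : Aut X) (h : pull B (baseMap α.inv) (unit u.hom) = unit u.hom) :
    α * u * α⁻¹ = u := by
  apply Aut.ext
  change α.inv ≫ u.hom ≫ α.hom = u.hom
  apply hom_ext
  · rw [degFr_conj' α hu.2, hu.2]
  · rw [baseMap_conj' α hu.1, hu.1]
  · rw [div_conj' α hu.1 hu.2, div_eq_one_of_mem_units hΦ hu, map_one]
  · rw [unit_conj' α hu.1 hu.2, h]

/-- `Div_B` of a pulled-back `Div_B`-trivial function vanishes. [cite: MochizukiFrdI2008, Thm. 5.2 p.100] -/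
theorem divB_pull_eq_one_of_divB_eq_one {A A' : D} (g : A' ⟶ A) (ξ : B.obj (op A))
    (hξ : divB Φ B DivB (op A) ξ = 1) : divB Φ B DivB (op A') (pull B g ξ) = 1 := by
  change divB Φ B DivB (op A') ((B.map g.op).hom ξ) = 1
  rw [← pullGp_divB, hξ, map_one]

/-- For `u ∈ O^×(A)`, `u_{u^N} = (u_u)^N` (`α ↦ u_α` is a homomorphism). [cite: MochizukiFrdI2008, Thm. 5.2 (ii) p.101] -/
theorem unit_pow_hom_of_mem_units {X : ModelFrobenioid Φ B DivB} {u : Aut X} (hu : u ∈ units X) (N : ℕ) :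
    unit (u ^ N).hom = unit u.hom ^ N := by
  have h := congrArg (fun x : (B.obj (op X.base))ˣ => (x : B.obj (op X.base))) (map_pow (unitsToRatFn X) ⟨u, hu⟩ N)
  simp only [Units.val_pow_eq_pow_val, coe_unitsToRatFn, Subgroup.coe_pow] at h
  exact h

end Literature.AlgebraicGeometry.Frobenioids.ModelFrobenioid

/-! ## §C. Over `B^temp(Π^tp_X)⁰`: `H_⊙`-decks lie over `A_⊙^bs`; `hL` from roots of `H_⊙`-invariant units -/

namespace Literature.AnabelianGeometry.EtaleTheta

open Literature.AlgebraicGeometry.Frobenioids Literature.AnabelianGeometry.SemiGraphs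
  Literature.AlgebraicGeometry.Frobenioids.QuasiTemperoid.BTempConnected

namespace BiKummerSetting

section Connected

variable {K : Type u₀} [Field K] (X : SemiGraphs.TemperedArithmeticGroup.{u₀} K) {D₀ : Type u₀} [Category.{v₀} D₀]
  {V : FrdIMonoidStub.{w}} {T₀ : RealifiedDivisorMonoids (D₀ := D₀) V}
  {VD : FrdICatStub.{u₀ + 1, u₀, w} (ConnectedPart (BTemp X.Pi))}
  (tf : TemperedFrobenioid T₀ (ConnectedPart (BTemp X.Pi)) VD) (hZ : tf.monoidType = MonoidType.Z)
  (hP : ∀ A : (ConnectedPart (BTemp X.Pi))ᵒᵖ, IsPerfect (tf.Φ.carrier A))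
  (NH : Subgroup (Field.absoluteGaloisGroup K) → tf.category → ℕ+ → Prop)
  (A₀ : tf.category) (hA₀ : PreFrobenioid.IsFrobeniusTrivial tf.toElem A₀) (hA₀' : SemiGraphs.IsGaloisObj A₀.base.obj)

/-- **`H_⊙` acts by deck transformations OVER `A_⊙^bs`** (Def. 4.1 p.86 «the open subgroup `H_⊙ ⊆ Π^tp_X` determined
by `A_⊙^bs`»; Def. 4.1 (ii) naturality of the Galois surjections, a THEOREM over `B^temp(Π^tp_X)⁰`): for a Galois
`A^bs`, every `b : A^bs ⟶ A_⊙^bs` and every `g ∈ H_⊙ = Ker(Π^tp_X ↠ Aut(A_⊙^bs))` (normal), the deck transformation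
of `A^bs` named by `g` lies OVER `b`. [cite: MochizukiEtTh2009, Def 4.1 p.87] -/
theorem galoisSurj_hom_comp_eq_of_mem_Hodot {A : ConnectedPart (BTemp X.Pi)} (hA : SemiGraphs.IsGaloisObj A.obj)
    (b : A ⟶ A₀.base) {g : X.Pi} (hg : g ∈ (mkOfConnectedTemperoid X tf hZ hP NH A₀ hA₀ hA₀').Hodot) :
    ((mkOfConnectedTemperoid X tf hZ hP NH A₀ hA₀ hA₀').galoisSurj A hA g).hom ≫ b = b := by
  obtain ⟨c, hc⟩ := mkOfConnectedTemperoid_galoisSurj_natural X tf hZ hP NH A₀ hA₀ hA₀' hA₀' hA b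
  have hg' : g ∈ ((mkOfConnectedTemperoid X tf hZ hP NH A₀ hA₀ hA₀').galoisSurj A₀.base hA₀').ker := hg
  have hker : c * g * c⁻¹ ∈ ((mkOfConnectedTemperoid X tf hZ hP NH A₀ hA₀ hA₀').galoisSurj A₀.base hA₀').ker :=
    (MonoidHom.normal_ker _).conj_mem g hg' c
  rw [MonoidHom.mem_ker] at hker
  rw [hc g, hker]
  exact Category.comp_id b

/-- **The roots-of-constants law `hL` (GAP G-w4d044-1) from `N`-th ROOTS OF `H_⊙`-INVARIANT UNITS** — the [EtTh]-side
half of the printed step p.90 L14–17 PROVED over `B^temp(Π^tp_X)⁰` for ANY `(N, H_⊙^{bs-fld})`-saturation predicate `NH`: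
if every unit of a Frobenius-trivial, `NH`-saturated `A″` over `A_⊙` that is fixed under conjugation by all lifts to
`Aut_C(A″)` of the deck transformations named by `H_⊙` admits an `N`-th root in `O^×(A″)` (`hroot` — [FrdII] Rmk. 2.2.1
«any element `f ∈ O^□(A)^H` admits an `N`-th root» read through the lifts; at the faithful [FrdII] Def. 2.2 (ii)
reading it is the named fact `PadicKummer.SaturatedInvariantsAdmitRoots` of the Def. 2.2 context, whose `H_A` acts
through exactly these lifts), then the pull-back to `A″` of every `Div_B`-trivial `ξ ∈ B(A_⊙^bs)` has an `N`-th root in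
`B(A″^bs)`: it is the function `u_u` of a unit `u` ([FrdI] Thm. 5.2 (ii)), `H_⊙`-lifts act OVER `A_⊙^bs`
(`galoisSurj_hom_comp_eq_of_mem_Hodot`) hence fix `u` (`conj_eq_self_of_pull_unit_eq`), and the root `r`, `r^N = u`,
gives `ζ := u_r`. [cite: MochizukiEtTh2009, Prop 4.2 p.90] -/
theorem Prop42Sub.constantRoots_mkOfConnectedTemperoid_of_invariantUnitRoots
    (hΦd : Objectwise (fun M _ => IsDivisorial M) tf.divisorMonoid)
    (hroot : ∀ (A'' : tf.category) (N : ℕ+), (A''.base ⟶ A₀.base) →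
      PreFrobenioid.IsFrobeniusTrivial tf.toElem A'' →
      NH (mkOfConnectedTemperoid X tf hZ hP NH A₀ hA₀ hA₀').HodotBsFld A'' N →
      ∀ u : Aut A'', u ∈ tf.units A'' →
        (∀ (hA : SemiGraphs.IsGaloisObj A''.base.obj) (g : X.Pi),
          g ∈ (mkOfConnectedTemperoid X tf hZ hP NH A₀ hA₀ hA₀').Hodot →
          ∀ α : Aut A'', ModelFrobenioid.baseMap α.hom =
            ((mkOfConnectedTemperoid X tf hZ hP NH A₀ hA₀ hA₀').galoisSurj A''.base hA g).hom →
            α * u * α⁻¹ = u) →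
        ∃ r : Aut A'', r ∈ tf.units A'' ∧ r ^ (N : ℕ) = u) :
    ∀ (A'' : tf.category) (N : ℕ+) (g : A''.base ⟶ A₀.base) (ξ : tf.ratFnFunctor.obj (op A₀.base)),
      PreFrobenioid.IsFrobeniusTrivial tf.toElem A'' →
      NH (mkOfConnectedTemperoid X tf hZ hP NH A₀ hA₀ hA₀').HodotBsFld A'' N →
      divB tf.divisorMonoid tf.ratFnFunctor tf.divBNatTrans (op A₀.base) ξ = 1 →
        ∃ ζ : tf.ratFnFunctor.obj (op A''.base), ζ ^ (N : ℕ) = pull tf.ratFnFunctor g ξ := by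
  intro A'' N g ξ hft hsat hξ
  -- the unit `u = (1, id, 0, g^* ξ)` of `A″`
  have hw : divB tf.divisorMonoid tf.ratFnFunctor tf.divBNatTrans (op A''.base) (pull tf.ratFnFunctor g ξ) = 1 :=
    ModelFrobenioid.divB_pull_eq_one_of_divB_eq_one g ξ hξ
  obtain ⟨u, hu, huw⟩ := ModelFrobenioid.exists_mem_units_unit_eq A'' (tf.ratFnFunctor_isGroupLike_holds A''.base)
    (pull tf.ratFnFunctor g ξ) hw
  -- `u` is fixed by every lift of a deck transformation named by `H_⊙`
  have hinv : ∀ (hA : SemiGraphs.IsGaloisObj A''.base.obj) (g' : X.Pi),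
      g' ∈ (mkOfConnectedTemperoid X tf hZ hP NH A₀ hA₀ hA₀').Hodot →
      ∀ α : Aut A'', ModelFrobenioid.baseMap α.hom =
        ((mkOfConnectedTemperoid X tf hZ hP NH A₀ hA₀ hA₀').galoisSurj A''.base hA g').hom → α * u * α⁻¹ = u := by
    intro hA g' hg' α hα
    apply ModelFrobenioid.conj_eq_self_of_pull_unit_eq (hΦd A''.base).isSharp hu α
    have h1 : ModelFrobenioid.baseMap α.hom ≫ g = g := by
      rw [hα]
      exact galoisSurj_hom_comp_eq_of_mem_Hodot X tf hZ hP NH A₀ hA₀ hA₀' hA g hg'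
    have h2 : ModelFrobenioid.baseMap α.inv ≫ g = g := by
      calc ModelFrobenioid.baseMap α.inv ≫ g
          = ModelFrobenioid.baseMap α.inv ≫ ModelFrobenioid.baseMap α.hom ≫ g := by rw [h1]
        _ = g := by rw [← Category.assoc, ModelFrobenioid.baseMap_inv_comp_hom, Category.id_comp]
    rw [huw, ← pull_comp, h2]
  -- the `N`-th root of `u` in `O^×(A″)` and its function
  obtain ⟨r, hr, hrN⟩ := hroot A'' N g hft hsat u ⟨hu.1, hu.2⟩ hinv
  refine ⟨ModelFrobenioid.unit r.hom, ?_⟩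
  rw [← ModelFrobenioid.unit_pow_hom_of_mem_units ⟨hr.1, hr.2⟩, hrN, huw]

/-- **[EtTh] Prop. 4.2 (iii) ∧ (iv) AS TYPED over `B^temp(Π^tp_X)⁰` with the roots-of-constants law `hL` (G-w4d044-1)
REPLACED by `N`-th roots of `H_⊙`-invariant units** (`hroot`, [FrdII] Rmk. 2.2.1 read through the lifts): ⇐ {`Φ`
divisorial, `hDSpull`, `hR` (G-w4d044-3), `hE` (G-w4d044-2), `hroot`} — abc-iut-w6-d037's
`prop42_iii_iv_mkOfConnectedTemperoid_of_laws` ∘ `constantRoots_mkOfConnectedTemperoid_of_invariantUnitRoots`.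
[cite: MochizukiEtTh2009, Prop 4.2 p.88] -/
theorem Prop42Sub.prop42_iii_iv_mkOfConnectedTemperoid_of_invariantUnitRoots
    (hΦd : Objectwise (fun M _ => IsDivisorial M) tf.divisorMonoid)
    (hDSpull : ∀ {A A' : ConnectedPart (BTemp X.Pi)} (e : A' ⟶ A) {a b : tf.Φ.carrier (op A)},
      (∀ x : tf.Φ.carrier (op A), x ∣ a → x ∣ b → x = 1) →
        ∀ y : tf.Φ.carrier (op A'), y ∣ pull tf.divisorMonoid e a → y ∣ pull tf.divisorMonoid e b → y = 1)
    (hR : ∀ (N : ℕ+) (A : ConnectedPart (BTemp X.Pi)), SemiGraphs.IsGaloisObj A.obj →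
      ∀ f : tf.ratFnFunctor.obj (op A),
        ∃ (A' : ConnectedPart (BTemp X.Pi)) (_ : SemiGraphs.IsGaloisObj A'.obj) (b : A' ⟶ A)
          (g : tf.ratFnFunctor.obj (op A')), g ^ (N : ℕ) = pull tf.ratFnFunctor b f)
    (hE : ∀ (N : ℕ+) (A' : tf.category), PreFrobenioid.IsFrobeniusTrivial tf.toElem A' →
      SemiGraphs.IsGaloisObj A'.base.obj →
        ∃ (A'' : tf.category) (ψ : A'' ⟶ A'), PreFrobenioid.IsPullbackMorphism tf.toElem ψ ∧
          SemiGraphs.IsGaloisObj A''.base.obj ∧ tf.IsMuSaturated A'' N ∧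
            NH (mkOfConnectedTemperoid X tf hZ hP NH A₀ hA₀ hA₀').HodotBsFld A'' N)
    (hroot : ∀ (A'' : tf.category) (N : ℕ+), (A''.base ⟶ A₀.base) →
      PreFrobenioid.IsFrobeniusTrivial tf.toElem A'' →
      NH (mkOfConnectedTemperoid X tf hZ hP NH A₀ hA₀ hA₀').HodotBsFld A'' N →
      ∀ u : Aut A'', u ∈ tf.units A'' →
        (∀ (hA : SemiGraphs.IsGaloisObj A''.base.obj) (g : X.Pi),
          g ∈ (mkOfConnectedTemperoid X tf hZ hP NH A₀ hA₀ hA₀').Hodot →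
          ∀ α : Aut A'', ModelFrobenioid.baseMap α.hom =
            ((mkOfConnectedTemperoid X tf hZ hP NH A₀ hA₀ hA₀').galoisSurj A''.base hA g).hom →
            α * u * α⁻¹ = u) →
        ∃ r : Aut A'', r ∈ tf.units A'' ∧ r ^ (N : ℕ) = u) :
    (mkOfConnectedTemperoid X tf hZ hP NH A₀ hA₀ hA₀').Prop42_iii (fun {_ _} φ x => tf.pullFracModel φ x) ∧
      (mkOfConnectedTemperoid X tf hZ hP NH A₀ hA₀ hA₀').Prop42_iv (fun φ x => tf.pullFracModel φ x) :=
  Prop42Sub.prop42_iii_iv_mkOfConnectedTemperoid_of_laws X tf hZ hP NH A₀ hA₀ hA₀' hΦd hDSpull hR hE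
    (Prop42Sub.constantRoots_mkOfConnectedTemperoid_of_invariantUnitRoots X tf hZ hP NH A₀ hA₀ hA₀' hΦd hroot)

end Connected

/-! ## §D. At the B2 datum `def22Ctx` with the FAITHFUL saturation slot: G-w4d044-1 / G-w4d044-2 closed -/

section Faithful

variable {K : Type} [Field K] (X : SemiGraphs.TemperedArithmeticGroup.{0} K) {D₀ : Type} [Category.{0} D₀]
  {V : FrdIMonoidStub.{0}} {T₀ : RealifiedDivisorMonoids (D₀ := D₀) V}
  {VD : FrdICatStub.{1, 0, 0} (ConnectedPart (BTemp X.Pi))}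
  (tf : TemperedFrobenioid T₀ (ConnectedPart (BTemp X.Pi)) VD) (hZ : tf.monoidType = MonoidType.Z)
  (hP : ∀ A : (ConnectedPart (BTemp X.Pi))ᵒᵖ, IsPerfect (tf.Φ.carrier A))
  (haug : IsOpenMap X.aug)
  (act : ∀ A : tf.category, MulDistribMulAction (Aut (TemperedFrobenioid.AE X tf haug A)) ↥(tf.units A))
  (hact : ∀ (A : tf.category) (α : Aut A) (u : ↥(tf.units A)), (TemperedFrobenioid.resE X tf haug A α) • u =
    (⟨α * u.1 * α⁻¹, (tf.units_normal A).conj_mem _ u.2 α⟩ : ↥(tf.units A)))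
  (NHf : Subgroup (Field.absoluteGaloisGroup K) → tf.category → ℕ+ → Prop)
  (A₀ : tf.category) (hA₀ : PreFrobenioid.IsFrobeniusTrivial tf.toElem A₀) (hA₀' : SemiGraphs.IsGaloisObj A₀.base.obj)
  (hHn : (mkOfConnectedTemperoid X tf hZ hP NHf A₀ hA₀ hA₀').HodotBsFld.Normal)
  (hHo : IsOpen ((mkOfConnectedTemperoid X tf hZ hP NHf A₀ hA₀ hA₀').HodotBsFld : Set (Field.absoluteGaloisGroup K)))

/-- **`hroot` AT THE B2 DATUM ⟸ [FrdII] Rmk. 2.2.1 BY NAME.**  If the setting's saturation slot `NHf` READS [FrdII]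
Def. 2.2 (ii) saturation of the context `def22Ctx` (`hNHf`, one direction; definitional at the faithful slot), then
«`N`-th roots of `H_⊙`-invariant units» (`hroot` of `constantRoots_mkOfConnectedTemperoid_of_invariantUnitRoots`) follows
from the named fact `PadicKummer.SaturatedInvariantsAdmitRoots (def22Ctx A″) N` (`h221`, Rmk. 2.2.1 «any
`f ∈ O^□(A)^H` admits an `N`-th root») for the Frobenius-trivial `A″` over `A_⊙`: every `h ∈ H_A = Im(H_⊙^{bs-fld})` is
`outer (aug g̃) = aug_*(galoisSurj g̃)` (`outerRep_aug`), `g̃ ∈ H_⊙`, `= res α` for a lift `α ∈ Aut_C(A″)` of that deck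
transformation (`A″` Frobenius-trivial ⇒ `Aut`-ample, abc-iut-w6-d047's `exists_aut_mapAut_eq_of_isFrobeniusTrivial`), and
`res α • u = α u α⁻¹` (`hact`) `= u`. [cite: MochizukiFrdII2008, Rmk 2.2.1 p.18] -/
theorem Prop42Sub.invariantUnitRoots_of_def22Ctx
    (hNHf : ∀ (H : Subgroup (Field.absoluteGaloisGroup K)) (A : tf.category) (N : ℕ+), NHf H A N →
      ∃ (hn : H.Normal) (ho : IsOpen (H : Set (Field.absoluteGaloisGroup K))),
        PadicKummer.IsNHSaturated (TemperedFrobenioid.def22Ctx X tf haug A (act A) (hact A) H hn ho) N)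
    (h221 : ∀ (A'' : tf.category) (N : ℕ+), (A''.base ⟶ A₀.base) → PreFrobenioid.IsFrobeniusTrivial tf.toElem A'' →
      PadicKummer.SaturatedInvariantsAdmitRoots (TemperedFrobenioid.def22Ctx X tf haug A'' (act A'') (hact A'')
        (mkOfConnectedTemperoid X tf hZ hP NHf A₀ hA₀ hA₀').HodotBsFld hHn hHo) N) :
    ∀ (A'' : tf.category) (N : ℕ+), (A''.base ⟶ A₀.base) → PreFrobenioid.IsFrobeniusTrivial tf.toElem A'' →
      NHf (mkOfConnectedTemperoid X tf hZ hP NHf A₀ hA₀ hA₀').HodotBsFld A'' N →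
      ∀ u : Aut A'', u ∈ tf.units A'' →
        (∀ (hA : SemiGraphs.IsGaloisObj A''.base.obj) (g : X.Pi),
          g ∈ (mkOfConnectedTemperoid X tf hZ hP NHf A₀ hA₀ hA₀').Hodot →
          ∀ α : Aut A'', ModelFrobenioid.baseMap α.hom =
            ((mkOfConnectedTemperoid X tf hZ hP NHf A₀ hA₀ hA₀').galoisSurj A''.base hA g).hom → α * u * α⁻¹ = u) →
        ∃ r : Aut A'', r ∈ tf.units A'' ∧ r ^ (N : ℕ) = u := by
  intro A'' N b hft hsat u hu hinv
  obtain ⟨hn, ho, hsat'⟩ := hNHf _ A'' N hsat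
  have hA : SemiGraphs.IsGaloisObj A''.base.obj := hsat'.galois
  have hfix : ∀ h : (TemperedFrobenioid.def22Ctx X tf haug A'' (act A'') (hact A'')
      (mkOfConnectedTemperoid X tf hZ hP NHf A₀ hA₀ hA₀').HodotBsFld hHn hHo).HA,
      (h : (TemperedFrobenioid.def22Ctx X tf haug A'' (act A'') (hact A'')
        (mkOfConnectedTemperoid X tf hZ hP NHf A₀ hA₀ hA₀').HodotBsFld hHn hHo).AutE) •
        (show (TemperedFrobenioid.def22Ctx X tf haug A'' (act A'') (hact A'')
          (mkOfConnectedTemperoid X tf hZ hP NHf A₀ hA₀ hA₀').HodotBsFld hHn hHo).O from ⟨u, hu⟩) = ⟨u, hu⟩ := by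
    intro h
    obtain ⟨x, hx, hxh⟩ := Subgroup.mem_map.mp h.2
    obtain ⟨g', hg', rfl⟩ := Subgroup.mem_map.mp hx
    obtain ⟨α, hα⟩ := tf.exists_aut_mapAut_eq_of_isFrobeniusTrivial A'' hft
      ((mkOfConnectedTemperoid X tf hZ hP NHf A₀ hA₀ hA₀').galoisSurj A''.base hA g')
    have hres : TemperedFrobenioid.resE X tf haug A'' α = h.1 := by
      rw [← hxh]
      change (TemperedFrobenioid.augPush X haug).mapAut A''.base (tf.baseFunctorOfCategory.mapAut A'' α) =
        TemperedFrobenioid.outerRep X tf haug A'' (X.aug g')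
      rw [hα, TemperedFrobenioid.outerRep_aug X tf haug A'' hA g']
      rfl
    have hbase : ModelFrobenioid.baseMap α.hom =
        ((mkOfConnectedTemperoid X tf hZ hP NHf A₀ hA₀ hA₀').galoisSurj A''.base hA g').hom := by
      rw [← hα]; rfl
    rw [← hres]
    change (TemperedFrobenioid.resE X tf haug A'' α) • (⟨u, hu⟩ : ↥(tf.units A'')) = (⟨u, hu⟩ : ↥(tf.units A''))
    rw [hact]
    exact Subtype.ext (hinv hA g' hg' α hbase)
  obtain ⟨g, hg⟩ := h221 A'' N b hft hsat' ⟨u, hu⟩ hfix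
  refine ⟨g.1, g.2, ?_⟩
  have hg' := congrArg Subtype.val hg
  have hpow : (g ^ (N : ℕ)).val = g.val ^ (N : ℕ) := Subgroup.coe_pow _ _ _
  rw [hpow] at hg'
  exact hg'

/-- **[EtTh] Prop. 4.2 (iii) ∧ (iv) AS TYPED over `B^temp(Π^tp_X)⁰` AT THE B2 DATUM `def22Ctx` with a saturation slot `NHf`
READING [FrdII] Def. 2.2 (ii) faithfully (`hNHf`, an `Iff` — `Iff.rfl` at the faithful slot, see `…_faithful` below)**: ⟸
{`Φ` divisorial, `hDSpull` ([FrdI] Prop. 4.1 (iii)), `hR` (root law, G-w4d044-3)} ∪ {the `def22Ctx` data `haug`/`act`/`hact`}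
∪ {[FrdII] Rmk. 2.2.1 ×2 AT THE INSTANCE, BY NAME: `h221` (`SaturatedInvariantsAdmitRoots` for the Frobenius-trivial `A″`
over `A_⊙`), `hex` (saturated pull-backs exist in `C`)}.  The dictionary of `Sec4Prop42SubLawsOfDef22Reading` (`ctx`, `hNH`,
`hNH'`, `ιO`, `hconst`, `hmu`, `hgal`) and the laws `hS`, `hHn`, `hHo` of abc-iut-w6-d047's `…_of_def22Ctx` are all gone:
`hE` (G-w4d044-2) by `refinementLaw_of_def22Ctx`, `hL` (G-w4d044-1) by `invariantUnitRoots_of_def22Ctx` ∘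
`constantRoots_mkOfConnectedTemperoid_of_invariantUnitRoots`. [cite: MochizukiEtTh2009, Prop 4.2 p.88] -/
theorem Prop42Sub.prop42_iii_iv_mkOfConnectedTemperoid_of_def22Ctx_reading
    (hNHf : ∀ (H : Subgroup (Field.absoluteGaloisGroup K)) (A : tf.category) (N : ℕ+), NHf H A N ↔
      ∃ (hn : H.Normal) (ho : IsOpen (H : Set (Field.absoluteGaloisGroup K))),
        PadicKummer.IsNHSaturated (TemperedFrobenioid.def22Ctx X tf haug A (act A) (hact A) H hn ho) N)
    (hΦd : Objectwise (fun M _ => IsDivisorial M) tf.divisorMonoid)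
    (hDSpull : ∀ {A A' : ConnectedPart (BTemp X.Pi)} (e : A' ⟶ A) {a b : tf.Φ.carrier (op A)},
      (∀ x : tf.Φ.carrier (op A), x ∣ a → x ∣ b → x = 1) →
        ∀ y : tf.Φ.carrier (op A'), y ∣ pull tf.divisorMonoid e a → y ∣ pull tf.divisorMonoid e b → y = 1)
    (hR : ∀ (N : ℕ+) (A : ConnectedPart (BTemp X.Pi)), SemiGraphs.IsGaloisObj A.obj →
      ∀ f : tf.ratFnFunctor.obj (op A),
        ∃ (A' : ConnectedPart (BTemp X.Pi)) (_ : SemiGraphs.IsGaloisObj A'.obj) (b : A' ⟶ A)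
          (g : tf.ratFnFunctor.obj (op A')), g ^ (N : ℕ) = pull tf.ratFnFunctor b f)
    (hex : ∀ (A' : tf.category) (N : ℕ+), ∃ (A'' : tf.category) (ψ : A'' ⟶ A'),
      PreFrobenioid.IsPullbackMorphism tf.toElem ψ ∧
        PadicKummer.IsNHSaturated (TemperedFrobenioid.def22Ctx X tf haug A'' (act A'') (hact A'')
          (mkOfConnectedTemperoid X tf hZ hP NHf A₀ hA₀ hA₀').HodotBsFld hHn hHo) N)
    (h221 : ∀ (A'' : tf.category) (N : ℕ+), (A''.base ⟶ A₀.base) → PreFrobenioid.IsFrobeniusTrivial tf.toElem A'' →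
      PadicKummer.SaturatedInvariantsAdmitRoots (TemperedFrobenioid.def22Ctx X tf haug A'' (act A'') (hact A'')
        (mkOfConnectedTemperoid X tf hZ hP NHf A₀ hA₀ hA₀').HodotBsFld hHn hHo) N) :
    (mkOfConnectedTemperoid X tf hZ hP NHf A₀ hA₀ hA₀').Prop42_iii (fun {_ _} φ x => tf.pullFracModel φ x) ∧
      (mkOfConnectedTemperoid X tf hZ hP NHf A₀ hA₀ hA₀').Prop42_iv (fun φ x => tf.pullFracModel φ x) :=
  Prop42Sub.prop42_iii_iv_mkOfConnectedTemperoid_of_invariantUnitRoots X tf hZ hP NHf A₀ hA₀ hA₀' hΦd hDSpull hR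
    (Prop42Sub.refinementLaw_of_def22Ctx (hZ := hZ) (hP := hP) (NH := NHf) (A₀ := A₀) (hA₀ := hA₀) (hA₀' := hA₀')
      haug act hact hHn hHo (fun A N h => (hNHf _ A N).2 ⟨hHn, hHo, h⟩) hex)
    (Prop42Sub.invariantUnitRoots_of_def22Ctx X tf hZ hP haug act hact NHf A₀ hA₀ hA₀' hHn hHo
      (fun H A N h => (hNHf H A N).1 h) h221)

/-- **[EtTh] Prop. 4.2 (iii) ∧ (iv) AS TYPED over `B^temp(Π^tp_X)⁰` AT THE FAITHFUL [FrdII] Def. 2.2 (ii) READING** — the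
free `(N, H_⊙^{bs-fld})`-saturation slot of Def. 4.1 (iii)(a) INSTANTIATED by «the [FrdII] Def. 2.2 context `def22Ctx A`
is `(N, H)`-saturated» (for normal open `H`; at `H := H_⊙^{bs-fld}`, normal and open by `hodotBsFld_normal` /
`isOpen_hodotBsFld_of_isOpenMap`), so that the reading is `Iff.rfl`: ⟸ {`Φ` divisorial, `hDSpull`, `hR` (G-w4d044-3)} ∪
{B2 data `haug`/`act`/`hact`} ∪ {[FrdII] Rmk. 2.2.1 ×2 at the instance BY NAME: `hex`, `h221`} — GAP rows G-w4d044-1 (`hL`)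
and G-w4d044-2 (`hE`) CLOSED at this reading (no law, no dictionary binder). [cite: MochizukiEtTh2009, Prop 4.2 p.88] -/
theorem Prop42Sub.prop42_iii_iv_mkOfConnectedTemperoid_faithful
    (hΦd : Objectwise (fun M _ => IsDivisorial M) tf.divisorMonoid)
    (hDSpull : ∀ {A A' : ConnectedPart (BTemp X.Pi)} (e : A' ⟶ A) {a b : tf.Φ.carrier (op A)},
      (∀ x : tf.Φ.carrier (op A), x ∣ a → x ∣ b → x = 1) →
        ∀ y : tf.Φ.carrier (op A'), y ∣ pull tf.divisorMonoid e a → y ∣ pull tf.divisorMonoid e b → y = 1)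
    (hR : ∀ (N : ℕ+) (A : ConnectedPart (BTemp X.Pi)), SemiGraphs.IsGaloisObj A.obj →
      ∀ f : tf.ratFnFunctor.obj (op A),
        ∃ (A' : ConnectedPart (BTemp X.Pi)) (_ : SemiGraphs.IsGaloisObj A'.obj) (b : A' ⟶ A)
          (g : tf.ratFnFunctor.obj (op A')), g ^ (N : ℕ) = pull tf.ratFnFunctor b f)
    (hex : ∀ (A' : tf.category) (N : ℕ+), ∃ (A'' : tf.category) (ψ : A'' ⟶ A'),
      PreFrobenioid.IsPullbackMorphism tf.toElem ψ ∧
        PadicKummer.IsNHSaturated (TemperedFrobenioid.def22Ctx X tf haug A'' (act A'') (hact A'')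
          (mkOfConnectedTemperoid X tf hZ hP (fun H A N => ∃ (hn : H.Normal)
              (ho : IsOpen (H : Set (Field.absoluteGaloisGroup K))),
              PadicKummer.IsNHSaturated (TemperedFrobenioid.def22Ctx X tf haug A (act A) (hact A) H hn ho) N)
            A₀ hA₀ hA₀').HodotBsFld
          (mkOfConnectedTemperoid X tf hZ hP (fun _ _ _ => True) A₀ hA₀ hA₀').hodotBsFld_normal
          ((mkOfConnectedTemperoid X tf hZ hP (fun _ _ _ => True) A₀ hA₀ hA₀').isOpen_hodotBsFld_of_isOpenMap
            (isOpen_Hodot_mkOfConnectedTemperoid X tf hZ hP _ A₀ hA₀ hA₀') haug)) N)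
    (h221 : ∀ (A'' : tf.category) (N : ℕ+), (A''.base ⟶ A₀.base) → PreFrobenioid.IsFrobeniusTrivial tf.toElem A'' →
      PadicKummer.SaturatedInvariantsAdmitRoots (TemperedFrobenioid.def22Ctx X tf haug A'' (act A'') (hact A'')
          (mkOfConnectedTemperoid X tf hZ hP (fun H A N => ∃ (hn : H.Normal)
              (ho : IsOpen (H : Set (Field.absoluteGaloisGroup K))),
              PadicKummer.IsNHSaturated (TemperedFrobenioid.def22Ctx X tf haug A (act A) (hact A) H hn ho) N)
            A₀ hA₀ hA₀').HodotBsFld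
          (mkOfConnectedTemperoid X tf hZ hP (fun _ _ _ => True) A₀ hA₀ hA₀').hodotBsFld_normal
          ((mkOfConnectedTemperoid X tf hZ hP (fun _ _ _ => True) A₀ hA₀ hA₀').isOpen_hodotBsFld_of_isOpenMap
            (isOpen_Hodot_mkOfConnectedTemperoid X tf hZ hP _ A₀ hA₀ hA₀') haug)) N) :
    (mkOfConnectedTemperoid X tf hZ hP (fun H A N => ∃ (hn : H.Normal)
          (ho : IsOpen (H : Set (Field.absoluteGaloisGroup K))),
          PadicKummer.IsNHSaturated (TemperedFrobenioid.def22Ctx X tf haug A (act A) (hact A) H hn ho) N)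
        A₀ hA₀ hA₀').Prop42_iii (fun {_ _} φ x => tf.pullFracModel φ x) ∧
      (mkOfConnectedTemperoid X tf hZ hP (fun H A N => ∃ (hn : H.Normal)
          (ho : IsOpen (H : Set (Field.absoluteGaloisGroup K))),
          PadicKummer.IsNHSaturated (TemperedFrobenioid.def22Ctx X tf haug A (act A) (hact A) H hn ho) N)
        A₀ hA₀ hA₀').Prop42_iv (fun φ x => tf.pullFracModel φ x) :=
  Prop42Sub.prop42_iii_iv_mkOfConnectedTemperoid_of_def22Ctx_reading X tf hZ hP haug act hact _ A₀ hA₀ hA₀' _ _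
    (fun _ _ _ => Iff.rfl) hΦd hDSpull hR hex h221

end Faithful

end BiKummerSetting

end Literature.AnabelianGeometry.EtaleTheta

end
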